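import Mathlib

/-!
# A1Lagrange — Lemma A2.2 (ii) of Tier-4 sub-claim A1: the Lagrange projector polynomial has
rational coefficients

Cell pub-hodge-repro2, seat p7 (sole filer). Companion of `route/T4-A1-p7.md` §A2 (Lemma A2.2).

The prose: `Λ ⊂ F₁` is the finite set of eigenvalues `χ_k(x)` of one algebraic correspondence
`[x]^*`, `Λ_W ⊂ Λ` the six Weil eigenvalues `σ(x)⁴`, both stable under `Gal(F₁/ℚ)`, and
`P(T) = Σ_{λ ∈ Λ_W} ∏_{μ ∈ Λ, μ ≠ λ} (T − μ)/(λ − μ)` is the Lagrange polynomial which is `1` on `Λ_W`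
and `0` on `Λ ∖ Λ_W`.  Lemma A2.2 (ii) says `P ∈ ℚ[T]`.

The polynomial `P` is written out as `∑ a ∈ W, Lagrange.basis Λ id a` (no new definition:
`Lagrange.basis Λ id λ = ∏_{μ ∈ Λ.erase λ} basisDivisor λ μ`, `basisDivisor λ μ = C (λ − μ)⁻¹ * (X − C μ)`).

* `map_lagrangeSum` — for an injective ring endomorphism `g` of the field that maps `Λ` into `Λ`
  and `Λ_W` into `Λ_W`, `P.map g = P` (the summands and the factors of each product are permuted).
* `lagrangeSum_mem_lifts` — if `L/ℚ` is a finite Galois extension and `Λ`, `Λ_W` are stable under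
  every `ℚ`-automorphism of `L`, then `P` is the image of a polynomial with `ℚ`-coefficients
  (`P ∈ Polynomial.lifts (algebraMap ℚ L)`), i.e. `∃ Q : ℚ[X], Q.map (algebraMap ℚ L) = P`.
* `eval_lagrangeSum_of_mem`, `eval_lagrangeSum_of_notMem` — Lemma A2.2 (i): `P` is `1` on `Λ_W`
  and `0` on `Λ ∖ Λ_W`.

Standard axioms only; imports Mathlib only.
-/

namespace Summit.Ventures.HodgeRepro2.A1Lagrange

open Polynomial Finset

variable {L : Type*} [Field L] [DecidableEq L]

/-- Lemma A2.2 (i), first half: `P(λ) = 1` for `λ ∈ W ⊆ Λ`. -/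
theorem eval_lagrangeSum_of_mem (Λ W : Finset L) (hWΛ : W ⊆ Λ) {a : L} (ha : a ∈ W) :
    (∑ a ∈ W, Lagrange.basis Λ id a).eval a = 1 := by
  rw [eval_finsetSum, Finset.sum_eq_single a]
  · exact Lagrange.eval_basis_self (v := id) Function.injective_id.injOn (hWΛ ha)
  · intro b hb hba
    exact Lagrange.eval_basis_of_ne (v := id) hba (hWΛ ha)
  · intro h; exact absurd ha h

/-- Lemma A2.2 (i), second half: `P(μ) = 0` for `μ ∈ Λ ∖ W`. -/
theorem eval_lagrangeSum_of_notMem (Λ W : Finset L) {b : L} (hb : b ∈ Λ) (hbW : b ∉ W) :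
    (∑ a ∈ W, Lagrange.basis Λ id a).eval b = 0 := by
  rw [eval_finsetSum]
  apply Finset.sum_eq_zero
  intro a ha
  have hab : a ≠ b := fun h => hbW (h ▸ ha)
  exact Lagrange.eval_basis_of_ne (v := id) hab hb

omit [Field L] in
/-- A finite set mapped into itself by an injective map is mapped onto itself. -/
theorem image_eq_self_of_mapsTo {g : L → L} (hg : Function.Injective g) (Λ : Finset L)
    (hΛ : ∀ a ∈ Λ, g a ∈ Λ) : Λ.image g = Λ := by
  apply Finset.eq_of_subset_of_card_le
  · intro b hb
    obtain ⟨a, ha, rfl⟩ := Finset.mem_image.mp hb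
    exact hΛ a ha
  · rw [Finset.card_image_of_injective _ hg]

omit [DecidableEq L] in
/-- `basisDivisor` is transported by a ring homomorphism of fields. -/
theorem map_basisDivisor (g : L →+* L) (x y : L) :
    (Lagrange.basisDivisor x y).map g = Lagrange.basisDivisor (g x) (g y) := by
  unfold Lagrange.basisDivisor
  simp [Polynomial.map_mul, Polynomial.map_sub, map_inv₀, map_sub]

/-- A Lagrange basis polynomial is transported to the basis polynomial of the image node when the
node set is mapped onto itself. -/
theorem map_lagrangeBasis (g : L →+* L) (hg : Function.Injective g) (Λ : Finset L)
    (hΛ : ∀ a ∈ Λ, g a ∈ Λ) (a : L) :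
    (Lagrange.basis Λ id a).map g = Lagrange.basis Λ id (g a) := by
  unfold Lagrange.basis
  rw [Polynomial.map_prod]
  simp only [id_eq, map_basisDivisor]
  have himg : (Λ.erase a).image g = Λ.erase (g a) := by
    rw [Finset.image_erase hg, image_eq_self_of_mapsTo hg Λ hΛ]
  rw [← himg, Finset.prod_image (fun x _ y _ hxy => hg hxy)]

/-- Lemma A2.2 (ii), invariance form: an injective ring endomorphism `g` preserving `Λ` and `W`
fixes the Lagrange projector polynomial (`g` permutes the summands and the factors). -/
theorem map_lagrangeSum (g : L →+* L) (hg : Function.Injective g) (Λ W : Finset L)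
    (hΛ : ∀ a ∈ Λ, g a ∈ Λ) (hW : ∀ a ∈ W, g a ∈ W) :
    (∑ a ∈ W, Lagrange.basis Λ id a).map g = ∑ a ∈ W, Lagrange.basis Λ id a := by
  rw [Polynomial.map_sum]
  simp only [map_lagrangeBasis g hg Λ hΛ]
  have himg : W.image g = W := image_eq_self_of_mapsTo hg W hW
  conv_rhs => rw [← himg, Finset.sum_image (fun x _ y _ hxy => hg hxy)]

/-- Lemma A2.2 (ii): over a finite Galois extension `L/ℚ`, if `Λ` and `W` are stable under every
`ℚ`-automorphism, the Lagrange projector polynomial has coefficients in `ℚ`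
(`P ∈ lifts (algebraMap ℚ L)`, i.e. `∃ Q : ℚ[X], Q.map (algebraMap ℚ L) = P`). -/
theorem lagrangeSum_mem_lifts [Algebra ℚ L] [FiniteDimensional ℚ L] [IsGalois ℚ L]
    (Λ W : Finset L) (hΛ : ∀ g : L ≃ₐ[ℚ] L, ∀ a ∈ Λ, g a ∈ Λ)
    (hW : ∀ g : L ≃ₐ[ℚ] L, ∀ a ∈ W, g a ∈ W) :
    (∑ a ∈ W, Lagrange.basis Λ id a) ∈ Polynomial.lifts (algebraMap ℚ L) := by
  rw [Polynomial.lifts_iff_coeff_lifts]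
  intro n
  rw [IsGalois.mem_range_algebraMap_iff_fixed]
  intro g
  have h := map_lagrangeSum (g : L →+* L) g.injective Λ W (hΛ g) (hW g)
  have hc := congrArg (fun p : L[X] => p.coeff n) h
  simpa [Polynomial.coeff_map] using hc

/-- The same, as an explicit rational polynomial. -/
theorem exists_rat_poly_map_eq [Algebra ℚ L] [FiniteDimensional ℚ L] [IsGalois ℚ L]
    (Λ W : Finset L) (hΛ : ∀ g : L ≃ₐ[ℚ] L, ∀ a ∈ Λ, g a ∈ Λ)
    (hW : ∀ g : L ≃ₐ[ℚ] L, ∀ a ∈ W, g a ∈ W) :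
    ∃ Q : ℚ[X], Q.map (algebraMap ℚ L) = ∑ a ∈ W, Lagrange.basis Λ id a :=
  (Polynomial.mem_lifts _).mp (lagrangeSum_mem_lifts Λ W hΛ hW)

end Summit.Ventures.HodgeRepro2.A1Lagrange
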